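import Mathlib
import Literature.NumberTheory.Sieve.PretentiousDistance
import HarnessLib

/-!
# Elliott–Kish 2017, Theorem 2, Step 3: exactness `g(p) = χ(p)` via an eratosthenian sieve

Topic `Literature/NumberTheory/LFunctions`. Everything in this file is PROVED; no definitions, no
named facts. Second of two files (`ElliottKishRigidity`, `ElliottKishExactness`) formalizing
Steps 2–3 of the proof of Elliott–Kish, Mathematika **63** (2017), **Theorem 2**, for finite-order
completely multiplicative `g` with `g(an+1) = g(An+1)` (`a ≠ A` positive). This file is elementary
(no analysis): it takes the output of Step 2 — a character `χ₀` mod `q₀` with `𝔻(g, χ₀; x)²`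
bounded — and proves `g(p₀) = χ₀(p₀)` for every prime `p₀ ∤ q₀ a A`.

The printed Step 3 ([EK] p. 927–928) offers two methods: Lemma 4 via Stepanauskas' asymptotic
formula for correlations (Lemma 5), or — "in the narrower context that `g` has a fixed non-zero
value on all but finitely many of the ratios" — the SECOND METHOD: "let `p ∤ a`. If `p^s ∥ Δ`
then … we can arrange that `p^r ∥ (an+b)`, `r > s`, `p^{-r}(an+b)`, `p^{-s}(An+B)` free of prime
factors of `Δ`. Since `g(p)^r` has a constant value for `r > s`, `g(p) = 1`. Enhanced by an
eratosthenian sieve, this second method will then obviate appeal to Lemma 5". This file follows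
the second method, with the eratosthenian sieve made explicit (`sieve_linear_forms`).

## Contents
* `ElliottKish2017.exists_tail_le` — tails of a convergent `∑_{p ∈ P} 1/p` are small.
* `ElliottKish2017.modEq_of_dvd_linear`, `exists_residue_of_linear`, `exists_not_dvd_of_three_le`,
  `card_filter_mod_eq_le` — a linear form not identically `0 (mod p)` vanishes on `≤ 1` class.
* `ElliottKish2017.sieve_linear_forms` — for a thin set `P` of primes `≥ 3` and two linear forms
  with no local obstruction, some `m` has `(αm+β)(γm+δ)` free of primes from `P` (CRT for the
  primes `≤ z₁`, counting for the primes `> z₁`: each removes `≤ 2(Y/p+1)` of `Y` values).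
* `ElliottKish2017.exists_gap_of_pow_eq_one` — `L`-th roots of unity `≠ 1` have `1 - Re z ≥ c_L > 0`;
  `sum_inv_le_of_pretentiousDistSq_le` — hence the exceptional primes `{p ∤ q₀ : g(p) ≠ χ₀(p)}`
  are thin ([EK], end of Step 2).
* `ElliottKish2017.apply_eq_char_of_pretentiousDistSq_le` — Step 3: `g(p₀) = χ₀(p₀)` for
  `p₀ ∤ q₀ a A` (with `n = e q₀ n'`, `e ∈ {1, 2}`, `s = v_{p₀}(e q₀ |A - a|)`, `r = s + 1`,
  `n' ≡ c₀ (mod p₀^{r+1})` forcing `p₀^r ∥ an+1` and `p₀^s ∥ An+1`, cofactors sieved free of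
  exceptional primes, whence `g(p₀)^r χ₀(u) = g(p₀)^s χ₀(v)` and `χ₀(p₀)^r χ₀(u) = 1 = χ₀(p₀)^s χ₀(v)`).

## References
* P. D. T. A. Elliott, J. Kish, Mathematika 63 (2017) 919–943, doi:10.1112/S0025579317000304,
  §2 Step 3 and Lemma 4 (read: held text `paper:doi-10-1112-s0025579317000304`, pp. 8–10).
  [ElliottKish2017]

## Design choices
* `g : ℕ → ℂ` is completely multiplicative and unimodular on `n ≥ 1` only (values at `0` unused),
  matching the stripped function of Klurman–Kurlberg 2019, Prop. 2.1; the Step-2 input is the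
  hypothesis `∀ x, Sieve.pretentiousDistSq g (fun n => χ₀ n) x ≤ R`.
* Thinness of a set of primes is phrased as a uniform bound on `∑ 1/p` over its finite subsets.
* NOT here: the quantitative modulus of [EK] Theorem 2 (Step 4), Lemmas 4–6 as printed.
-/

open scoped ComplexConjugate
open Finset Real

namespace Literature.NumberTheory.LFunctions

namespace ElliottKish2017

/-! ### Thin sets of primes: tails of a convergent `∑ 1/p` -/

/-- If every finite subset of `P` has `∑ 1/p ≤ R'`, then the tails are small: for every `η > 0`
there is `z` such that every finite subset of `P ∩ (z, ∞)` has `∑ 1/p ≤ η`. [folklore] -/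
theorem exists_tail_le {P : Set ℕ} {R' : ℝ}
    (hsum : ∀ s : Finset ℕ, (∀ p ∈ s, p ∈ P) → ∑ p ∈ s, (1 : ℝ) / p ≤ R') {η : ℝ} (hη : 0 < η) :
    ∃ z : ℕ, ∀ s : Finset ℕ, (∀ p ∈ s, p ∈ P ∧ z < p) → ∑ p ∈ s, (1 : ℝ) / p ≤ η := by
  set S : Set ℝ := {r | ∃ s : Finset ℕ, (∀ p ∈ s, p ∈ P) ∧ r = ∑ p ∈ s, (1 : ℝ) / p} with hS
  have hne : S.Nonempty := ⟨0, ∅, by simp⟩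
  have hbdd : BddAbove S := ⟨R', by rintro r ⟨s, hs, rfl⟩; exact hsum s hs⟩
  obtain ⟨r₀, ⟨s₀, hs₀, rfl⟩, hr₀⟩ := exists_lt_of_lt_csSup hne (sub_lt_self (sSup S) hη)
  refine ⟨s₀.sup id, fun s hs => ?_⟩
  have hdisj : Disjoint s₀ s := by
    rw [Finset.disjoint_left]
    intro p hp hp'
    have h1 : p ≤ s₀.sup id := Finset.le_sup (f := id) hp
    have h2 := (hs p hp').2
    omega
  have hunion : ∑ p ∈ s₀ ∪ s, (1 : ℝ) / p ≤ sSup S :=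
    le_csSup hbdd ⟨s₀ ∪ s, fun p hp => by
      rcases Finset.mem_union.1 hp with h | h
      · exact hs₀ p h
      · exact (hs p h).1, rfl⟩
  rw [Finset.sum_union hdisj] at hunion
  linarith

/-! ### Roots of a linear congruence -/

/-- A linear form `αm + β` that is not identically zero modulo the prime `p` vanishes mod `p` on
at most one residue class. [folklore] -/
theorem modEq_of_dvd_linear {p α β : ℕ} (hp : p.Prime) (hαβ : ¬ (p ∣ α ∧ p ∣ β)) {m m' : ℕ}
    (hm : p ∣ α * m + β) (hm' : p ∣ α * m' + β) : m ≡ m' [MOD p] := by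
  haveI := Fact.mk hp
  have h1 : ((α * m + β : ℕ) : ZMod p) = 0 := (ZMod.natCast_eq_zero_iff _ _).2 hm
  have h2 : ((α * m' + β : ℕ) : ZMod p) = 0 := (ZMod.natCast_eq_zero_iff _ _).2 hm'
  push_cast at h1 h2
  have hα : (α : ZMod p) ≠ 0 := by
    intro hα
    rw [hα, zero_mul, zero_add] at h1
    exact hαβ ⟨(ZMod.natCast_eq_zero_iff _ _).1 hα, (ZMod.natCast_eq_zero_iff _ _).1 h1⟩
  have h3 : (α : ZMod p) * m = (α : ZMod p) * m' := by
    have := h1.trans h2.symm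
    exact add_right_cancel this
  have h4 : (m : ZMod p) = m' := mul_left_cancel₀ hα h3
  exact (ZMod.natCast_eq_natCast_iff _ _ _).1 h4

/-- The multiples of a prime `p` among the values `αm + β` of a linear form not identically zero
mod `p` lie in a single residue class of `m` mod `p`. [folklore] -/
theorem exists_residue_of_linear {p α β : ℕ} (hp : p.Prime) (hαβ : ¬ (p ∣ α ∧ p ∣ β)) :
    ∃ c : ℕ, ∀ m : ℕ, p ∣ α * m + β → m % p = c := by
  by_cases h : ∃ m₀, p ∣ α * m₀ + β
  · obtain ⟨m₀, hm₀⟩ := h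
    exact ⟨m₀ % p, fun m hm => modEq_of_dvd_linear hp hαβ hm hm₀⟩
  · push Not at h
    exact ⟨0, fun m hm => absurd hm (h m)⟩

/-- Among `0, 1, 2` there is a value at which the product of two linear forms, neither identically
zero modulo the prime `p ≥ 3`, is not divisible by `p`. [folklore] -/
theorem exists_not_dvd_of_three_le {p α β γ δ : ℕ} (hp : p.Prime) (h3 : 3 ≤ p)
    (hαβ : ¬ (p ∣ α ∧ p ∣ β)) (hγδ : ¬ (p ∣ γ ∧ p ∣ δ)) :
    ∃ c : ℕ, ¬ p ∣ (α * c + β) * (γ * c + δ) := by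
  obtain ⟨c₁, hc₁⟩ := exists_residue_of_linear hp hαβ
  obtain ⟨c₂, hc₂⟩ := exists_residue_of_linear hp hγδ
  -- pick `c ∈ {0, 1, 2}` with `c % p ∉ {c₁, c₂}`
  have key : ∃ c : ℕ, c < 3 ∧ c % p ≠ c₁ ∧ c % p ≠ c₂ := by
    have h0 : (0 : ℕ) % p = 0 := Nat.zero_mod p
    have h1 : (1 : ℕ) % p = 1 := Nat.mod_eq_of_lt (by omega)
    have h2 : (2 : ℕ) % p = 2 := Nat.mod_eq_of_lt (by omega)
    by_cases ha : (0 : ℕ) % p ≠ c₁ ∧ (0 : ℕ) % p ≠ c₂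
    · exact ⟨0, by norm_num, ha⟩
    by_cases hb : (1 : ℕ) % p ≠ c₁ ∧ (1 : ℕ) % p ≠ c₂
    · exact ⟨1, by norm_num, hb⟩
    refine ⟨2, by norm_num, ?_, ?_⟩ <;> omega
  obtain ⟨c, -, hc1, hc2⟩ := key
  refine ⟨c, fun hdvd => ?_⟩
  rcases (Nat.Prime.dvd_mul hp).1 hdvd with h | h
  · exact hc1 (hc₁ c h)
  · exact hc2 (hc₂ c h)

/-- Counting a residue class in an initial segment: `#{m < Y : m % p = c} ≤ Y / p + 1`. [folklore] -/
theorem card_filter_mod_eq_le (p c Y : ℕ) :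
    ((Finset.range Y).filter (fun m => m % p = c)).card ≤ Y / p + 1 := by
  have hinj : Set.InjOn (fun m => m / p) ((Finset.range Y).filter (fun m => m % p = c) : Set ℕ) := by
    intro m hm m' hm' h
    simp only [Finset.coe_filter, Set.mem_setOf_eq] at hm hm' h
    rw [← Nat.div_add_mod m p, ← Nat.div_add_mod m' p, h, hm.2, hm'.2]
  have hmaps : Set.MapsTo (fun m => m / p) ((Finset.range Y).filter (fun m => m % p = c) : Set ℕ)
      (Finset.range (Y / p + 1) : Set ℕ) := by
    intro m hm
    simp only [Finset.coe_filter, Set.mem_setOf_eq, Finset.mem_range] at hm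
    simp only [Finset.coe_range, Set.mem_Iio]
    exact Nat.lt_succ_of_le (Nat.div_le_div_right hm.1.le)
  calc ((Finset.range Y).filter (fun m => m % p = c)).card ≤ (Finset.range (Y / p + 1)).card :=
        Finset.card_le_card_of_injOn _ hmaps hinj
    _ = Y / p + 1 := Finset.card_range _

/-! ### The sieve lemma -/

set_option maxHeartbeats 400000 in
/-- **Eratosthenian sieve for two linear forms over a thin set of odd primes.** Let `P` be a set
of primes `≥ 3` whose finite subsets have bounded `∑ 1/p`, and let `αm + β`, `γm + δ`
(`β, δ ≥ 1`) be linear forms neither of which vanishes identically modulo any `p ∈ P`. Then some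
`m` makes `(αm + β)(γm + δ)` free of prime factors from `P`. (The "second method" of
Elliott–Kish 2017, §2 Step 3: "Enhanced by an eratosthenian sieve, this second method will then
obviate appeal to Lemma 5"; the primes `≤ z₁` are handled by one CRT class, the primes `> z₁` by
counting: each removes `≤ 2(Y/p + 1)` of `Y` consecutive values.) [cite: ElliottKish2017, §2 Step 3] -/
theorem sieve_linear_forms {P : Set ℕ} (hP : ∀ p ∈ P, p.Prime ∧ 3 ≤ p) {R' : ℝ}
    (hsum : ∀ s : Finset ℕ, (∀ p ∈ s, p ∈ P) → ∑ p ∈ s, (1 : ℝ) / p ≤ R')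
    {α β γ δ : ℕ} (hβ : 0 < β) (hδ : 0 < δ)
    (hloc : ∀ p ∈ P, ¬ (p ∣ α ∧ p ∣ β) ∧ ¬ (p ∣ γ ∧ p ∣ δ)) :
    ∃ m : ℕ, ∀ p ∈ P, ¬ p ∣ (α * m + β) * (γ * m + δ) := by
  classical
  obtain ⟨z₁, hz₁⟩ := exists_tail_le hsum (by norm_num : (0 : ℝ) < 1 / 16)
  -- the small primes and one good class modulo their product
  set S : Finset ℕ := (Finset.range (z₁ + 1)).filter (· ∈ P) with hS
  have hSP : ∀ p ∈ S, p ∈ P := fun p hp => (Finset.mem_filter.1 hp).2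
  have hgood : ∀ p ∈ S, ∃ c, ¬ p ∣ (α * c + β) * (γ * c + δ) := fun p hp =>
    exists_not_dvd_of_three_le (hP p (hSP p hp)).1 (hP p (hSP p hp)).2 (hloc p (hSP p hp)).1
      (hloc p (hSP p hp)).2
  choose! c hc using hgood
  obtain ⟨m₁, hm₁⟩ := Nat.chineseRemainderOfFinset c id S
    (fun p hp => (hP p (hSP p hp)).1.ne_zero)
    (fun p hp q hq hpq => (Nat.coprime_primes (hP p (hSP p hp)).1 (hP q (hSP q hq)).1).2 hpq)
  set Pz : ℕ := ∏ p ∈ S, p with hPz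
  have hF : ∀ {p m m' : ℕ}, m ≡ m' [MOD p] →
      (α * m + β) * (γ * m + δ) ≡ (α * m' + β) * (γ * m' + δ) [MOD p] :=
    fun h => ((h.mul_left α).add_right β).mul ((h.mul_left γ).add_right δ)
  have hsmall : ∀ p ∈ S, ∀ m'' : ℕ,
      ¬ p ∣ (α * (Pz * m'' + m₁) + β) * (γ * (Pz * m'' + m₁) + δ) := by
    intro p hp m'' hdvd
    have hpdvd : p ∣ Pz := Finset.dvd_prod_of_mem _ hp
    have hmod : Pz * m'' + m₁ ≡ c p [MOD p] := by
      have h1 : Pz * m'' + m₁ ≡ 0 * m'' + m₁ [MOD p] :=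
        ((Nat.modEq_zero_iff_dvd.2 hpdvd).mul_right m'').add_right m₁
      rw [zero_mul, zero_add] at h1
      exact h1.trans (hm₁ p hp)
    exact hc p hp (((hF hmod).dvd_iff dvd_rfl).1 hdvd)
  -- the shifted linear forms
  set α₁ : ℕ := α * Pz with hα₁
  set β₁ : ℕ := α * m₁ + β with hβ₁
  set γ₁ : ℕ := γ * Pz with hγ₁
  set δ₁ : ℕ := γ * m₁ + δ with hδ₁
  have hF₁ : ∀ m'' : ℕ, (α * (Pz * m'' + m₁) + β) * (γ * (Pz * m'' + m₁) + δ)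
      = (α₁ * m'' + β₁) * (γ₁ * m'' + δ₁) := by
    intro m''
    simp only [hα₁, hβ₁, hγ₁, hδ₁]
    ring
  have hβ₁pos : 1 ≤ β₁ := by rw [hβ₁]; omega
  have hδ₁pos : 1 ≤ δ₁ := by rw [hδ₁]; omega
  set K : ℕ := α₁ + β₁ + γ₁ + δ₁ with hK
  have hK1 : 1 ≤ K := by rw [hK]; omega
  have hK0 : (0 : ℝ) < K := by exact_mod_cast hK1
  obtain ⟨z₂', hz₂'⟩ := exists_tail_le hsum (by positivity : (0 : ℝ) < 1 / (16 * K))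
  set z₂ : ℕ := max z₁ z₂' with hz₂
  set Y : ℕ := 4 * (z₂ + 1) with hY
  have hY1 : 1 ≤ Y := by rw [hY]; omega
  -- no local obstruction at the big primes either
  have hbig : ∀ p ∈ P, z₁ < p → ¬ (p ∣ α₁ ∧ p ∣ β₁) ∧ ¬ (p ∣ γ₁ ∧ p ∣ δ₁) := by
    intro p hpP hpz
    have hp := (hP p hpP).1
    have hpPz : ¬ p ∣ Pz := by
      intro h
      obtain ⟨q, hq, hpq⟩ := (Prime.dvd_finsetProd_iff hp.prime _).1 h
      have hq' := (hP q (hSP q hq)).1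
      have hpq' : p = q := (Nat.prime_dvd_prime_iff_eq hp hq').1 hpq
      have hqz : q < z₁ + 1 := Finset.mem_range.1 (Finset.mem_filter.1 hq).1
      omega
    refine ⟨?_, ?_⟩
    · rintro ⟨h1, h2⟩
      have hα : p ∣ α := ((Nat.Prime.dvd_mul hp).1 h1).resolve_right hpPz
      have hβ' : p ∣ β := (Nat.dvd_add_right (dvd_mul_of_dvd_left hα m₁)).1 h2
      exact (hloc p hpP).1 ⟨hα, hβ'⟩
    · rintro ⟨h1, h2⟩
      have hγ : p ∣ γ := ((Nat.Prime.dvd_mul hp).1 h1).resolve_right hpPz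
      have hδ' : p ∣ δ := (Nat.dvd_add_right (dvd_mul_of_dvd_left hγ m₁)).1 h2
      exact (hloc p hpP).2 ⟨hγ, hδ'⟩
  -- the bad set `B ⊆ [0, Y)` and the relevant big primes `T ⊆ (z₁, K Y]`
  set B : Finset ℕ := (Finset.range Y).filter
    (fun m'' => ∃ p, p ∈ P ∧ z₁ < p ∧ p ∣ (α₁ * m'' + β₁) * (γ₁ * m'' + δ₁)) with hB
  set T : Finset ℕ := (Finset.range (K * Y + 1)).filter (fun p => p ∈ P ∧ z₁ < p) with hT
  set Bp : ℕ → Finset ℕ := fun p =>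
    (Finset.range Y).filter (fun m'' => p ∣ (α₁ * m'' + β₁) * (γ₁ * m'' + δ₁)) with hBp
  have hBsub : B ⊆ T.biUnion Bp := by
    intro m'' hm
    rw [Finset.mem_filter] at hm
    obtain ⟨hmY, p, hpP, hpz, hpd⟩ := hm
    rw [Finset.mem_biUnion]
    refine ⟨p, Finset.mem_filter.2 ⟨Finset.mem_range.2 ?_, hpP, hpz⟩,
      Finset.mem_filter.2 ⟨hmY, hpd⟩⟩
    have hp := (hP p hpP).1
    have hmY' : m'' < Y := Finset.mem_range.1 hmY
    have hle : p ≤ K * Y := by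
      rcases (Nat.Prime.dvd_mul hp).1 hpd with h | h
      · have hpos : 0 < α₁ * m'' + β₁ := by positivity
        calc p ≤ α₁ * m'' + β₁ := Nat.le_of_dvd hpos h
          _ ≤ α₁ * Y + β₁ * Y := by nlinarith
          _ ≤ K * Y := by rw [hK]; nlinarith
      · have hpos : 0 < γ₁ * m'' + δ₁ := by positivity
        calc p ≤ γ₁ * m'' + δ₁ := Nat.le_of_dvd hpos h
          _ ≤ γ₁ * Y + δ₁ * Y := by nlinarith
          _ ≤ K * Y := by rw [hK]; nlinarith
    omega
  have hcardp : ∀ p ∈ T, ((Bp p).card : ℝ) ≤ 2 * ((Y : ℝ) / p + 1) := by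
    intro p hp
    obtain ⟨-, hpP, hpz⟩ := Finset.mem_filter.1 hp
    have hpr := (hP p hpP).1
    obtain ⟨h1, h2⟩ := hbig p hpP hpz
    obtain ⟨c₁, hc₁⟩ := exists_residue_of_linear hpr h1
    obtain ⟨c₂, hc₂⟩ := exists_residue_of_linear hpr h2
    have hsub : Bp p ⊆ (Finset.range Y).filter (fun m => m % p = c₁)
        ∪ (Finset.range Y).filter (fun m => m % p = c₂) := by
      intro m'' hm
      rw [Finset.mem_filter] at hm
      rw [Finset.mem_union, Finset.mem_filter, Finset.mem_filter]
      rcases (Nat.Prime.dvd_mul hpr).1 hm.2 with h | h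
      · exact Or.inl ⟨hm.1, hc₁ _ h⟩
      · exact Or.inr ⟨hm.1, hc₂ _ h⟩
    have hcd := (Finset.card_le_card hsub).trans (Finset.card_union_le _ _)
    have e1 := card_filter_mod_eq_le p c₁ Y
    have e2 := card_filter_mod_eq_le p c₂ Y
    have hdiv : ((Y / p : ℕ) : ℝ) ≤ (Y : ℝ) / p := Nat.cast_div_le
    calc ((Bp p).card : ℝ) ≤ ((Y / p + 1 + (Y / p + 1) : ℕ) : ℝ) := by
          exact_mod_cast hcd.trans (add_le_add e1 e2)
      _ ≤ 2 * ((Y : ℝ) / p + 1) := by push_cast; linarith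
  have hTsum : ∑ p ∈ T, (1 : ℝ) / p ≤ 1 / 16 :=
    hz₁ T fun p hp => ⟨(Finset.mem_filter.1 hp).2.1, (Finset.mem_filter.1 hp).2.2⟩
  have hTcard : (T.card : ℝ) ≤ ((z₂ : ℝ) + 1) + (Y : ℝ) / 16 := by
    have hsplit := Finset.card_filter_add_card_filter_not (s := T) (fun p => p ≤ z₂)
    have h1 : (T.filter (fun p => p ≤ z₂)).card ≤ z₂ + 1 := by
      calc (T.filter (fun p => p ≤ z₂)).card ≤ (Finset.range (z₂ + 1)).card :=
            Finset.card_le_card fun p hp => Finset.mem_range.2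
              (Nat.lt_succ_of_le (Finset.mem_filter.1 hp).2)
        _ = z₂ + 1 := Finset.card_range _
    have h2 : ((T.filter (fun p => ¬ p ≤ z₂)).card : ℝ) ≤ (Y : ℝ) / 16 := by
      have hT₂sum : ∑ p ∈ T.filter (fun p => ¬ p ≤ z₂), (1 : ℝ) / p ≤ 1 / (16 * K) := by
        refine hz₂' _ fun p hp => ?_
        rw [Finset.mem_filter, Finset.mem_filter] at hp
        refine ⟨hp.1.2.1, ?_⟩
        have := hp.2
        push Not at this
        exact lt_of_le_of_lt (le_max_right _ _) this
      have hle : ∀ p ∈ T.filter (fun p => ¬ p ≤ z₂), (1 : ℝ) ≤ ((K * Y : ℕ) : ℝ) * (1 / p) := by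
        intro p hp
        rw [Finset.mem_filter, Finset.mem_filter] at hp
        have hpKY : p < K * Y + 1 := Finset.mem_range.1 hp.1.1
        have hp0 : (0 : ℝ) < p := by exact_mod_cast (hP p hp.1.2.1).1.pos
        rw [mul_one_div, le_div_iff₀ hp0, one_mul]
        exact_mod_cast Nat.lt_succ_iff.1 hpKY
      calc ((T.filter (fun p => ¬ p ≤ z₂)).card : ℝ)
          = ∑ p ∈ T.filter (fun p => ¬ p ≤ z₂), (1 : ℝ) := by simp
        _ ≤ ∑ p ∈ T.filter (fun p => ¬ p ≤ z₂), ((K * Y : ℕ) : ℝ) * (1 / p) :=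
            Finset.sum_le_sum hle
        _ = ((K * Y : ℕ) : ℝ) * ∑ p ∈ T.filter (fun p => ¬ p ≤ z₂), (1 : ℝ) / p := by
            rw [Finset.mul_sum]
        _ ≤ ((K * Y : ℕ) : ℝ) * (1 / (16 * K)) := by gcongr
        _ = (Y : ℝ) / 16 := by push_cast; field_simp
    have hsplit' : (T.card : ℝ)
        = ((T.filter (fun p => p ≤ z₂)).card : ℝ) + ((T.filter (fun p => ¬ p ≤ z₂)).card : ℝ) := by
      exact_mod_cast hsplit.symm
    rw [hsplit']
    exact add_le_add (by exact_mod_cast h1) h2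
  have hBcard : (B.card : ℝ) < Y := by
    have hY' : (Y : ℝ) = 4 * ((z₂ : ℝ) + 1) := by rw [hY]; push_cast; ring
    calc (B.card : ℝ) ≤ ((T.biUnion Bp).card : ℝ) := by exact_mod_cast Finset.card_le_card hBsub
      _ ≤ ∑ p ∈ T, ((Bp p).card : ℝ) := by exact_mod_cast Finset.card_biUnion_le
      _ ≤ ∑ p ∈ T, 2 * ((Y : ℝ) / p + 1) := Finset.sum_le_sum hcardp
      _ = 2 * Y * ∑ p ∈ T, (1 : ℝ) / p + 2 * T.card := by
          have e : ∀ p ∈ T, 2 * ((Y : ℝ) / p + 1) = 2 * Y * (1 / p) + 2 := fun p _ => by ring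
          rw [Finset.sum_congr rfl e, Finset.sum_add_distrib, Finset.sum_const, nsmul_eq_mul,
            Finset.mul_sum]
          ring
      _ ≤ 2 * Y * (1 / 16) + 2 * (((z₂ : ℝ) + 1) + (Y : ℝ) / 16) := by gcongr
      _ < Y := by rw [hY']; nlinarith
  have hex : ∃ m'' ∈ Finset.range Y, m'' ∉ B := by
    by_contra h
    push Not at h
    have := Finset.card_le_card (show Finset.range Y ⊆ B from h)
    rw [Finset.card_range] at this
    exact absurd hBcard (not_lt.2 (by exact_mod_cast this))
  obtain ⟨m'', hmY, hmB⟩ := hex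
  refine ⟨Pz * m'' + m₁, fun p hpP hdvd => ?_⟩
  by_cases hpz : z₁ < p
  · exact hmB (Finset.mem_filter.2 ⟨hmY, p, hpP, hpz, by rwa [hF₁] at hdvd⟩)
  · have hpS : p ∈ S := Finset.mem_filter.2 ⟨Finset.mem_range.2 (by omega), hpP⟩
    exact hsmall p hpS m'' hdvd


/-! ### Roots of unity stay away from `1` -/

/-- The `L`-th roots of unity other than `1` satisfy `1 - Re z ≥ c_L > 0`. [folklore] -/
theorem exists_gap_of_pow_eq_one {L : ℕ} (hL : 0 < L) :
    ∃ c : ℝ, 0 < c ∧ ∀ z : ℂ, z ^ L = 1 → z ≠ 1 → c ≤ 1 - z.re := by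
  classical
  have hre : ∀ z : ℂ, z ^ L = 1 → z ≠ 1 → z.re < 1 := by
    intro z hz hz1
    have hnorm : ‖z‖ = 1 := by
      have h := congrArg norm hz
      rw [norm_pow, norm_one] at h
      exact (pow_eq_one_iff_of_nonneg (norm_nonneg _) hL.ne').1 h
    rcases (Complex.re_le_norm z).lt_or_eq with h | h
    · rwa [hnorm] at h
    · exfalso
      apply hz1
      have hsq : z.re * z.re + z.im * z.im = 1 := by
        have := Complex.normSq_eq_norm_sq z
        rw [hnorm, one_pow, Complex.normSq_apply] at this
        exact this
      rw [hnorm] at h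
      have him : z.im = 0 := by nlinarith
      exact Complex.ext (by simp [h]) (by simp [him])
  set S : Finset ℂ := (Polynomial.nthRootsFinset L (1 : ℂ)).erase 1 with hS
  by_cases hne : S.Nonempty
  · obtain ⟨z₀, hz₀, hmin⟩ := S.exists_min_image (fun z => 1 - z.re) hne
    have hz₀' := Finset.mem_erase.1 hz₀
    have hpow : z₀ ^ L = 1 := (Polynomial.mem_nthRootsFinset hL (1 : ℂ)).1 hz₀'.2
    refine ⟨1 - z₀.re, by linarith [hre z₀ hpow hz₀'.1], fun z hz hz1 => ?_⟩
    exact hmin z (Finset.mem_erase.2 ⟨hz1, (Polynomial.mem_nthRootsFinset hL (1 : ℂ)).2 hz⟩)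
  · refine ⟨1, one_pos, fun z hz hz1 => ?_⟩
    exact absurd ⟨z, Finset.mem_erase.2 ⟨hz1, (Polynomial.mem_nthRootsFinset hL (1 : ℂ)).2 hz⟩⟩ hne

/-! ### A bounded pretentious distance makes the exceptional primes thin -/

/-- If `𝔻(g, χ₀; x)² ≤ R` for all `x` and the exceptional primes (`p ∤ q₀`, `g(p) ≠ χ₀(p)`) have
summands `≥ c/p`, then every finite set of exceptional primes has `∑ 1/p ≤ R/c`. (Elliott–Kish
2017, §2, end of Step 2: "On the primes for which `g(p) ≠ χ(p)`, `g(p)χ̄(p)` is a non-trivial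
`mk`-th root of unity and the corresponding summands are uniformly bounded from below.")
[cite: ElliottKish2017, §2 Step 2] -/
theorem sum_inv_le_of_pretentiousDistSq_le {g : ℕ → ℂ} {q₀ : ℕ} (χ₀ : DirichletCharacter ℂ q₀)
    {R c : ℝ} (hc : 0 < c) (hg1 : ∀ p, p.Prime → ‖g p‖ ≤ 1)
    (hdist : ∀ x : ℝ, Sieve.pretentiousDistSq g (fun n => χ₀ n) x ≤ R)
    (hgap : ∀ p, p.Prime → ¬ p ∣ q₀ → g p ≠ χ₀ p → c ≤ 1 - (g p * conj (χ₀ p)).re)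
    (s : Finset ℕ) (hs : ∀ p ∈ s, p.Prime ∧ ¬ p ∣ q₀ ∧ g p ≠ χ₀ p) :
    ∑ p ∈ s, (1 : ℝ) / p ≤ R / c := by
  rw [le_div_iff₀ hc, Finset.sum_mul]
  have hsub : s ⊆ Nat.primesLE (s.sup id) := fun p hp =>
    Nat.mem_primesLE.2 ⟨Finset.le_sup (f := id) hp, (hs p hp).1⟩
  calc ∑ p ∈ s, 1 / (p : ℝ) * c ≤ ∑ p ∈ s, (1 - (g p * conj (χ₀ p)).re) / (p : ℝ) := by
        refine Finset.sum_le_sum fun p hp => ?_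
        obtain ⟨hpp, hpq, hne⟩ := hs p hp
        have hp0 : (0 : ℝ) < p := by exact_mod_cast hpp.pos
        rw [one_div_mul_eq_div]
        exact div_le_div_of_nonneg_right (hgap p hpp hpq hne) hp0.le
    _ ≤ ∑ p ∈ Nat.primesLE (s.sup id), (1 - (g p * conj (χ₀ p)).re) / (p : ℝ) := by
        refine Finset.sum_le_sum_of_subset_of_nonneg hsub fun p hp _ => ?_
        have hpp := (Nat.mem_primesLE.1 hp).2
        refine div_nonneg (sub_nonneg.2 ?_) (Nat.cast_nonneg p)
        calc (g p * conj (χ₀ p)).re ≤ ‖g p * conj (χ₀ p)‖ := Complex.re_le_norm _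
          _ = ‖g p‖ * ‖χ₀ p‖ := by rw [norm_mul, Complex.norm_conj]
          _ ≤ 1 * 1 := mul_le_mul (hg1 p hpp) (χ₀.norm_le_one _) (norm_nonneg _) zero_le_one
          _ = 1 := one_mul 1
    _ = Sieve.pretentiousDistSq g (fun n => χ₀ n) ((s.sup id : ℕ) : ℝ) := by
        unfold Sieve.pretentiousDistSq
        rw [Nat.floor_natCast]
    _ ≤ R := hdist _

/-! ### Multiplicativity helpers for `g : ℕ → ℂ` completely multiplicative on `n ≥ 1` -/

section CM

variable {g : ℕ → ℂ}

/-- `g 1 = 1` for `g` completely multiplicative and unimodular on the positive integers. [folklore] -/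
theorem cm_one (hg : ∀ m n : ℕ, 1 ≤ m → 1 ≤ n → g (m * n) = g m * g n)
    (hgu : ∀ n : ℕ, 1 ≤ n → ‖g n‖ = 1) : g 1 = 1 := by
  have h := hg 1 1 le_rfl le_rfl
  rw [one_mul] at h
  have h1 : g 1 ≠ 0 := fun h0 => by simpa [h0] using hgu 1 le_rfl
  have : g 1 * (g 1 - 1) = 0 := by rw [mul_sub, mul_one, ← h, sub_self]
  rcases mul_eq_zero.1 this with h' | h'
  · exact absurd h' h1
  · exact sub_eq_zero.1 h'

/-- `g(t^k) = g(t)^k` for `t ≥ 1`. [folklore] -/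
theorem cm_pow (hg : ∀ m n : ℕ, 1 ≤ m → 1 ≤ n → g (m * n) = g m * g n)
    (hgu : ∀ n : ℕ, 1 ≤ n → ‖g n‖ = 1) {t : ℕ} (ht : 1 ≤ t) (k : ℕ) : g (t ^ k) = g t ^ k := by
  induction k with
  | zero => rw [pow_zero, pow_zero, cm_one hg hgu]
  | succ k ih => rw [pow_succ, pow_succ, hg _ _ (Nat.one_le_pow _ _ ht) ht, ih]

/-- If `g` agrees with the Dirichlet character `χ₀` on every prime factor of `u ≥ 1`, then
`g u = χ₀ u`. [folklore] -/
theorem eq_char_of_primeFactors (hg : ∀ m n : ℕ, 1 ≤ m → 1 ≤ n → g (m * n) = g m * g n)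
    (hgu : ∀ n : ℕ, 1 ≤ n → ‖g n‖ = 1) {q₀ : ℕ} (χ₀ : DirichletCharacter ℂ q₀) :
    ∀ u : ℕ, 1 ≤ u → (∀ p ∈ u.primeFactors, g p = χ₀ p) → g u = χ₀ u := by
  intro u
  induction u using Nat.strong_induction_on with
  | _ u ih =>
    intro hu hpr
    rcases eq_or_lt_of_le hu with h1 | h1
    · rw [← h1, cm_one hg hgu, Nat.cast_one, map_one]
    · obtain ⟨p, hp, hpu⟩ := Nat.exists_prime_and_dvd h1.ne'
      obtain ⟨u', rfl⟩ := hpu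
      have hu' : 1 ≤ u' := Nat.pos_of_ne_zero fun h => by simp [h] at hu
      have hmem : p ∈ (p * u').primeFactors :=
        Nat.mem_primeFactors.2 ⟨hp, dvd_mul_right p u', by positivity⟩
      have hlt : u' < p * u' := lt_mul_of_one_lt_left (by omega) hp.one_lt
      have hsub : ∀ r ∈ u'.primeFactors, g r = χ₀ r := fun r hr =>
        hpr r (Nat.primeFactors_mono (dvd_mul_left u' p) (by positivity) hr)
      rw [hg p u' hp.one_lt.le hu', ih u' hlt hu' hsub, hpr p hmem, Nat.cast_mul, map_mul]

end CM


/-! ### Step 3 of Elliott–Kish: exactness at every prime `p₀ ∤ q₀ a A` -/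

section Exactness

variable {g : ℕ → ℂ}

/-- **Exactness, the case `a < A`.** Let `g` be completely multiplicative and unimodular on the
positive integers, of finite order (`g^m = 1`), with `g(an+1) = g(An+1)` for `n ≥ 1`, and suppose
`𝔻(g, χ₀; x)²` is bounded for a character `χ₀` mod `q₀`. Then `g(p₀) = χ₀(p₀)` for every prime
`p₀ ∤ q₀ a`. Proof ("second method" of Elliott–Kish 2017, §2 Step 3, p. 928: "let `p ∤ a`. If
`p^s ∥ Δ` then … we can arrange that `p^r ∥ (an+b)`, `r > s`, `p^{-r}(an+b)`, `p^{-s}(An+B)` free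
of prime factors of [the exceptional set]. Since `g(p)^r` has a constant value for `r > s`,
`g(p) = 1`"): with `n = e q₀ n'` (`e ∈ {1,2}`), `s = v_{p₀}(e q₀ (A - a))`, `r = s + 1` and
`n' ≡ c₀ (mod p₀^{r+1})` forcing `p₀^r ∥ a n + 1`, hence `p₀^s ∥ A n + 1`, the sieve lemma makes
the cofactors free of exceptional primes, so `g(p₀)^r χ₀(u) = g(p₀)^s χ₀(v)` with
`χ₀(p₀)^r χ₀(u) = 1 = χ₀(p₀)^s χ₀(v)`, i.e. `g(p₀) = χ₀(p₀)`. [cite: ElliottKish2017, §2 Step 3] -/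
theorem apply_eq_char_of_lt (hg : ∀ m n : ℕ, 1 ≤ m → 1 ≤ n → g (m * n) = g m * g n)
    (hgu : ∀ n : ℕ, 1 ≤ n → ‖g n‖ = 1) {m : ℕ} (hm : 0 < m)
    (hpow : ∀ n : ℕ, 1 ≤ n → g n ^ m = 1) {a A : ℕ} (ha : 0 < a) (haA : a < A)
    (hrel : ∀ n : ℕ, 1 ≤ n → g (a * n + 1) = g (A * n + 1)) {q₀ : ℕ} (hq₀ : 1 ≤ q₀)
    (χ₀ : DirichletCharacter ℂ q₀) {R : ℝ}
    (hdist : ∀ x : ℝ, Sieve.pretentiousDistSq g (fun n => χ₀ n) x ≤ R) {p₀ : ℕ} (hp₀ : p₀.Prime)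
    (hp₀q : ¬ p₀ ∣ q₀) (hp₀a : ¬ p₀ ∣ a) : g p₀ = χ₀ p₀ := by
  classical
  -- the gap and the thin exceptional set
  have hLpos : 0 < m * q₀.totient := Nat.mul_pos hm (Nat.totient_pos.2 hq₀)
  obtain ⟨c, hc, hgapL⟩ := exists_gap_of_pow_eq_one hLpos
  have hunit : ∀ {p : ℕ}, p.Prime → ¬ p ∣ q₀ →
      ‖χ₀ (p : ZMod q₀)‖ = 1 ∧ χ₀ (p : ZMod q₀) ^ q₀.totient = 1 := by
    intro p hp hpq
    obtain ⟨u, hu'⟩ := (ZMod.isUnit_prime_iff_not_dvd hp).2 hpq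
    refine ⟨by rw [← hu']; exact χ₀.unit_norm_eq_one u, ?_⟩
    rw [← hu', ← map_pow, ← Units.val_pow_eq_pow_val, ZMod.pow_totient, Units.val_one, map_one]
  have hgap : ∀ p, p.Prime → ¬ p ∣ q₀ → g p ≠ χ₀ p → c ≤ 1 - (g p * conj (χ₀ p)).re := by
    intro p hp hpq hne
    obtain ⟨hχn, hχφ⟩ := hunit hp hpq
    refine hgapL _ ?_ ?_
    · rw [mul_pow, ← map_pow, pow_mul, hpow p hp.one_lt.le, one_pow, one_mul, mul_comm, pow_mul,
        hχφ, one_pow, map_one]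
    · intro h1
      apply hne
      have hcc : conj (χ₀ (p : ZMod q₀)) * χ₀ (p : ZMod q₀) = 1 := by
        rw [mul_comm, Complex.mul_conj, Complex.normSq_eq_norm_sq, hχn]
        norm_num
      calc g p = g p * (conj (χ₀ (p : ZMod q₀)) * χ₀ (p : ZMod q₀)) := by rw [hcc, mul_one]
        _ = (g p * conj (χ₀ (p : ZMod q₀))) * χ₀ (p : ZMod q₀) := by ring
        _ = χ₀ p := by rw [h1, one_mul]
  have hthin := sum_inv_le_of_pretentiousDistSq_le χ₀ hc (fun p hp => (hgu p hp.one_lt.le).le)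
    hdist hgap
  -- parameters
  set e : ℕ := if p₀ = 2 then 1 else 2 with he
  have he0 : 0 < e := by rw [he]; split_ifs <;> norm_num
  have hep : ¬ p₀ ∣ e := by
    rw [he]
    split_ifs with h2
    · exact fun h => hp₀.one_lt.ne' (Nat.dvd_one.1 h)
    · exact fun h => h2 ((Nat.prime_dvd_prime_iff_eq hp₀ Nat.prime_two).1 h)
  set a' : ℕ := e * q₀ * a with ha'
  set A' : ℕ := e * q₀ * A with hA'
  have ha'0 : 0 < a' := by positivity
  have ha'A' : a' < A' := Nat.mul_lt_mul_of_pos_left haA (by positivity)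
  have hp₀a' : ¬ p₀ ∣ a' := by
    intro h
    rcases (Nat.Prime.dvd_mul hp₀).1 h with h | h
    · rcases (Nat.Prime.dvd_mul hp₀).1 h with h | h
      · exact hep h
      · exact hp₀q h
    · exact hp₀a h
  set D : ℕ := A' - a' with hD
  have hD0 : 0 < D := Nat.sub_pos_of_lt ha'A'
  haveI : Fact p₀.Prime := ⟨hp₀⟩
  set s : ℕ := padicValNat p₀ D with hs
  have hDs : p₀ ^ s ∣ D := pow_padicValNat_dvd
  have hDs' : ¬ p₀ ^ (s + 1) ∣ D := pow_succ_padicValNat_not_dvd hD0.ne'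
  -- `c₀` with `a' c₀ + 1 ≡ p₀^{s+1} (mod p₀^{s+2})`
  have hcop : Nat.Coprime a' (p₀ ^ (s + 2)) :=
    (Nat.coprime_comm.1 ((Nat.Prime.coprime_iff_not_dvd hp₀).2 hp₀a')).pow_right _
  obtain ⟨inv, -, hinv⟩ := Nat.exists_mul_mod_eq_one_of_coprime hcop
    (Nat.one_lt_pow (by omega) hp₀.one_lt)
  set c₀ : ℕ := inv * (p₀ ^ (s + 1) - 1) with hc₀
  have hpr1 : 1 ≤ p₀ ^ (s + 1) := Nat.one_le_pow _ _ hp₀.pos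
  have hc₀mod : a' * c₀ + 1 ≡ p₀ ^ (s + 1) [MOD p₀ ^ (s + 2)] := by
    have h1 : a' * inv ≡ 1 [MOD p₀ ^ (s + 2)] := by
      have := Nat.mod_modEq (a' * inv) (p₀ ^ (s + 2))
      rw [hinv] at this
      exact this.symm
    have h2 : a' * c₀ ≡ 1 * (p₀ ^ (s + 1) - 1) [MOD p₀ ^ (s + 2)] := by
      rw [hc₀, ← mul_assoc]
      exact h1.mul_right _
    rw [one_mul] at h2
    have h3 := h2.add_right 1
    rwa [Nat.sub_add_cancel hpr1] at h3
  -- valuation of `a' n' + 1` at `p₀` is exactly `s + 1` for `n' = p₀^{s+2} M + c₀`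
  have hval : ∀ M : ℕ, p₀ ^ (s + 1) ∣ a' * (p₀ ^ (s + 2) * M + c₀) + 1 ∧
      ¬ p₀ ^ (s + 2) ∣ a' * (p₀ ^ (s + 2) * M + c₀) + 1 := by
    intro M
    have hmod : a' * (p₀ ^ (s + 2) * M + c₀) + 1 ≡ p₀ ^ (s + 1) [MOD p₀ ^ (s + 2)] := by
      have h1 : a' * (p₀ ^ (s + 2) * M + c₀) + 1 = p₀ ^ (s + 2) * (a' * M) + (a' * c₀ + 1) := by
        ring
      rw [h1]
      have h2 : p₀ ^ (s + 2) * (a' * M) ≡ 0 [MOD p₀ ^ (s + 2)] :=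
        Nat.modEq_zero_iff_dvd.2 (dvd_mul_right _ _)
      have := h2.add hc₀mod
      rwa [zero_add] at this
    refine ⟨(hmod.dvd_iff (pow_dvd_pow p₀ (Nat.le_succ (s + 1)))).2 dvd_rfl, fun h => ?_⟩
    have h' := Nat.le_of_dvd (by positivity) ((hmod.dvd_iff dvd_rfl).1 h)
    have : p₀ ^ (s + 1) < p₀ ^ (s + 2) := Nat.pow_lt_pow_right hp₀.one_lt (by omega)
    omega
  -- valuation of `A' n' + 1` at `p₀` is exactly `s`
  have hDid : ∀ n' : ℕ, a' * (A' * n' + 1) + D = A' * (a' * n' + 1) := by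
    intro n'
    rw [hD]
    have := ha'A'.le
    zify [this]
    ring
  have hcopa : ∀ k : ℕ, Nat.Coprime (p₀ ^ k) a' := fun k =>
    Nat.Coprime.pow_left k ((Nat.Prime.coprime_iff_not_dvd hp₀).2 hp₀a')
  have hval2 : ∀ M : ℕ, p₀ ^ s ∣ A' * (p₀ ^ (s + 2) * M + c₀) + 1 ∧
      ¬ p₀ ^ (s + 1) ∣ A' * (p₀ ^ (s + 2) * M + c₀) + 1 := by
    intro M
    obtain ⟨h1, -⟩ := hval M
    have hid := hDid (p₀ ^ (s + 2) * M + c₀)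
    refine ⟨?_, fun h5 => ?_⟩
    · have h3 : p₀ ^ s ∣ A' * (a' * (p₀ ^ (s + 2) * M + c₀) + 1) :=
        Dvd.dvd.mul_left ((pow_dvd_pow p₀ (Nat.le_succ s)).trans h1) _
      rw [← hid] at h3
      exact (hcopa s).dvd_of_dvd_mul_left ((Nat.dvd_add_left hDs).1 h3)
    · have h6 : p₀ ^ (s + 1) ∣ a' * (A' * (p₀ ^ (s + 2) * M + c₀) + 1) := Dvd.dvd.mul_left h5 _
      have h7 : p₀ ^ (s + 1) ∣ A' * (a' * (p₀ ^ (s + 2) * M + c₀) + 1) := Dvd.dvd.mul_left h1 _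
      rw [← hid] at h7
      exact hDs' ((Nat.dvd_add_right h6).1 h7)
  -- the exceptional set for the sieve, and the linear forms
  set P' : Set ℕ := {p | p.Prime ∧ 3 ≤ p ∧ p ≠ p₀ ∧ ¬ p ∣ q₀ ∧ g p ≠ χ₀ p} with hP'
  have hlin1 : ∀ M : ℕ, a' * (p₀ ^ (s + 2) * M + c₀) + 1 = (a' * p₀ ^ (s + 2)) * M + (a' * c₀ + 1) := by
    intro M; ring
  have hlin2 : ∀ M : ℕ, A' * (p₀ ^ (s + 2) * M + c₀) + 1 = (A' * p₀ ^ (s + 2)) * M + (A' * c₀ + 1) := by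
    intro M; ring
  have hloc : ∀ p ∈ P', ¬ (p ∣ a' * p₀ ^ (s + 2) ∧ p ∣ a' * c₀ + 1) ∧
      ¬ (p ∣ A' * p₀ ^ (s + 2) ∧ p ∣ A' * c₀ + 1) := by
    rintro p ⟨hp, -, hpp₀, -, -⟩
    have hpp₀' : ¬ p ∣ p₀ ^ (s + 2) := fun h =>
      hpp₀ ((Nat.prime_dvd_prime_iff_eq hp hp₀).1 (hp.dvd_of_dvd_pow h))
    refine ⟨?_, ?_⟩
    · rintro ⟨h1, h2⟩
      have h3 : p ∣ a' := ((Nat.Prime.dvd_mul hp).1 h1).resolve_right hpp₀'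
      exact hp.one_lt.ne' (Nat.dvd_one.1 ((Nat.dvd_add_right (Dvd.dvd.mul_right h3 c₀)).1 h2))
    · rintro ⟨h1, h2⟩
      have h3 : p ∣ A' := ((Nat.Prime.dvd_mul hp).1 h1).resolve_right hpp₀'
      exact hp.one_lt.ne' (Nat.dvd_one.1 ((Nat.dvd_add_right (Dvd.dvd.mul_right h3 c₀)).1 h2))
  obtain ⟨M, hM⟩ := sieve_linear_forms (P := P') (fun p hp => ⟨hp.1, hp.2.1⟩) (R' := R / c)
    (fun t ht => hthin t fun p hp => ⟨(ht p hp).1, (ht p hp).2.2.2.1, (ht p hp).2.2.2.2⟩)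
    (Nat.succ_pos _) (Nat.succ_pos _) hloc
  -- the integer `n'` and the cofactors `u`, `v`
  obtain ⟨n', hn'⟩ : ∃ n' : ℕ, n' = p₀ ^ (s + 2) * M + c₀ := ⟨_, rfl⟩
  have hM' : ∀ p ∈ P', ¬ p ∣ (a' * n' + 1) * (A' * n' + 1) := fun p hp => by
    rw [hn', hlin1, hlin2]
    exact hM p hp
  have hv1' := hval M
  have hv2' := hval2 M
  rw [← hn'] at hv1' hv2'
  obtain ⟨⟨u, hu⟩, hu'⟩ := hv1'
  obtain ⟨⟨v, hv⟩, hv'⟩ := hv2'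
  have hp₀u : ¬ p₀ ∣ u := fun h => hu' (by rw [hu, pow_succ]; exact mul_dvd_mul_left _ h)
  have hp₀v : ¬ p₀ ∣ v := fun h => hv' (by rw [hv, pow_succ]; exact mul_dvd_mul_left _ h)
  have hu1 : 1 ≤ u := Nat.pos_of_ne_zero fun h => by rw [h, mul_zero] at hu; omega
  have hv1 : 1 ≤ v := Nat.pos_of_ne_zero fun h => by rw [h, mul_zero] at hv; omega
  -- every prime factor `p ≠ p₀` of `(a'n'+1)(A'n'+1)` has `g p = χ₀ p`
  have hfac : ∀ p : ℕ, p.Prime → p ∣ (a' * n' + 1) * (A' * n' + 1) → p ≠ p₀ → g p = χ₀ p := by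
    intro p hp hpd hpp₀
    by_contra hne
    have hpeq : ¬ p ∣ e * q₀ := by
      intro hd
      have hda' : p ∣ a' * n' := Dvd.dvd.mul_right (Dvd.dvd.mul_right hd a) n'
      have hdA' : p ∣ A' * n' := Dvd.dvd.mul_right (Dvd.dvd.mul_right hd A) n'
      rcases (Nat.Prime.dvd_mul hp).1 hpd with h | h
      · exact hp.one_lt.ne' (Nat.dvd_one.1 ((Nat.dvd_add_right hda').1 h))
      · exact hp.one_lt.ne' (Nat.dvd_one.1 ((Nat.dvd_add_right hdA').1 h))
    have hpq : ¬ p ∣ q₀ := fun h => hpeq (Dvd.dvd.mul_left h e)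
    have hp3 : 3 ≤ p := by
      by_contra hlt
      have hp2 : p = 2 := by have := hp.two_le; omega
      have he2 : e = 2 := by
        rw [he, if_neg]
        rintro rfl
        exact hpp₀ hp2
      exact hpeq (by rw [he2, hp2]; exact dvd_mul_right 2 q₀)
    exact hM' p ⟨hp, hp3, hpp₀, hpq, hne⟩ hpd
  have hgu' : g u = χ₀ u := eq_char_of_primeFactors hg hgu χ₀ u hu1 fun p hp => by
    have hpp := Nat.prime_of_mem_primeFactors hp
    have hpu := Nat.dvd_of_mem_primeFactors hp
    refine hfac p hpp ?_ ?_
    · rw [hu]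
      exact Dvd.dvd.mul_right (Dvd.dvd.mul_left hpu _) _
    · rintro rfl
      exact hp₀u hpu
  have hgv' : g v = χ₀ v := eq_char_of_primeFactors hg hgu χ₀ v hv1 fun p hp => by
    have hpp := Nat.prime_of_mem_primeFactors hp
    have hpv := Nat.dvd_of_mem_primeFactors hp
    refine hfac p hpp ?_ ?_
    · rw [hv]
      exact Dvd.dvd.mul_left (Dvd.dvd.mul_left hpv _) _
    · rintro rfl
      exact hp₀v hpv
  -- `n' ≥ 1`, so the relation applies at `n = e q₀ n'`
  have hn'1 : 1 ≤ n' := by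
    rcases Nat.eq_zero_or_pos n' with h0 | h0
    · exfalso
      rw [h0, mul_zero, zero_add] at hu
      have h1 : p₀ ^ (s + 1) ≤ 1 := Nat.le_of_dvd one_pos ⟨u, hu⟩
      have h2 : p₀ ≤ p₀ ^ (s + 1) := Nat.le_self_pow (by omega) p₀
      linarith [hp₀.two_le]
    · exact h0
  have hrel' : g (a' * n' + 1) = g (A' * n' + 1) := by
    have h := hrel (e * q₀ * n') (Nat.mul_pos (by positivity) hn'1)
    have e1 : a * (e * q₀ * n') = a' * n' := by rw [ha']; ring
    have e2 : A * (e * q₀ * n') = A' * n' := by rw [hA']; ring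
    rwa [e1, e2] at h
  rw [hu, hv, hg _ _ (Nat.one_le_pow _ _ hp₀.pos) hu1, hg _ _ (Nat.one_le_pow _ _ hp₀.pos) hv1,
    cm_pow hg hgu hp₀.pos, cm_pow hg hgu hp₀.pos, hgu', hgv'] at hrel'
  -- `χ₀(a'n'+1) = χ₀(A'n'+1) = 1`
  have hχ1 : ∀ x : ℕ, x ≡ 1 [MOD q₀] → χ₀ x = 1 := fun x hx => by
    have h : ((x : ℕ) : ZMod q₀) = 1 := by
      have := (ZMod.natCast_eq_natCast_iff x 1 q₀).2 hx
      rwa [Nat.cast_one] at this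
    rw [h, map_one]
  have hq₀a' : q₀ ∣ a' := Dvd.dvd.mul_right (dvd_mul_left q₀ e) a
  have hq₀A' : q₀ ∣ A' := Dvd.dvd.mul_right (dvd_mul_left q₀ e) A
  have hmod1 : a' * n' + 1 ≡ 1 [MOD q₀] := by
    have h0 : a' * n' ≡ 0 [MOD q₀] := Nat.modEq_zero_iff_dvd.2 (Dvd.dvd.mul_right hq₀a' n')
    simpa using h0.add_right 1
  have hmod2 : A' * n' + 1 ≡ 1 [MOD q₀] := by
    have h0 : A' * n' ≡ 0 [MOD q₀] := Nat.modEq_zero_iff_dvd.2 (Dvd.dvd.mul_right hq₀A' n')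
    simpa using h0.add_right 1
  have hχu : χ₀ p₀ ^ (s + 1) * χ₀ u = 1 := by
    have h := hχ1 _ hmod1
    rwa [hu, Nat.cast_mul, Nat.cast_pow, map_mul, map_pow] at h
  have hχv : χ₀ p₀ ^ s * χ₀ v = 1 := by
    have h := hχ1 _ hmod2
    rwa [hv, Nat.cast_mul, Nat.cast_pow, map_mul, map_pow] at h
  -- final algebra: `G^{s+1} X^s = G^s X^{s+1}` with `G X ≠ 0`
  have hG0 : g p₀ ≠ 0 := fun h => by simpa [h] using hgu p₀ hp₀.pos
  have hX0 : χ₀ (p₀ : ZMod q₀) ≠ 0 := fun h0 => by simpa [h0] using (hunit hp₀ hp₀q).1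
  have key : g p₀ ^ (s + 1) * χ₀ p₀ ^ s = g p₀ ^ s * χ₀ p₀ ^ (s + 1) := by
    calc g p₀ ^ (s + 1) * χ₀ p₀ ^ s
        = g p₀ ^ (s + 1) * χ₀ p₀ ^ s * (χ₀ p₀ ^ (s + 1) * χ₀ u) := by rw [hχu, mul_one]
      _ = χ₀ p₀ ^ s * χ₀ p₀ ^ (s + 1) * (g p₀ ^ (s + 1) * χ₀ u) := by ring
      _ = χ₀ p₀ ^ s * χ₀ p₀ ^ (s + 1) * (g p₀ ^ s * χ₀ v) := by rw [hrel']
      _ = g p₀ ^ s * χ₀ p₀ ^ (s + 1) * (χ₀ p₀ ^ s * χ₀ v) := by ring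
      _ = g p₀ ^ s * χ₀ p₀ ^ (s + 1) := by rw [hχv, mul_one]
  have hfin : (g p₀ * χ₀ p₀) ^ s * (g p₀ - χ₀ p₀) = 0 := by
    rw [mul_pow]
    linear_combination key
  rcases mul_eq_zero.1 hfin with h | h
  · exact absurd h (pow_ne_zero _ (mul_ne_zero hG0 hX0))
  · exact sub_eq_zero.1 h

/-- **Elliott–Kish 2017, §2 Step 3 (exactness), for finite-order functions.** Let `g` be
completely multiplicative and unimodular on the positive integers with `g^m = 1`, let
`g(an+1) = g(An+1)` for all `n ≥ 1` (`a ≠ A` positive), and let `χ₀` be a Dirichlet character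
mod `q₀ ≥ 1` with `𝔻(g, χ₀; x)²` bounded in `x` (the output of Step 2). Then `g(p) = χ₀(p)` for
every prime `p ∤ q₀ a A` ("`g(p) = χ(p)` provided `(p, D) = 1`, `(p, aAΔ) = 1`").
[cite: ElliottKish2017, §2 Step 3] -/
theorem apply_eq_char_of_pretentiousDistSq_le
    (hg : ∀ m n : ℕ, 1 ≤ m → 1 ≤ n → g (m * n) = g m * g n)
    (hgu : ∀ n : ℕ, 1 ≤ n → ‖g n‖ = 1) {m : ℕ} (hm : 0 < m)
    (hpow : ∀ n : ℕ, 1 ≤ n → g n ^ m = 1) {a A : ℕ} (ha : 0 < a) (hA : 0 < A) (haA : a ≠ A)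
    (hrel : ∀ n : ℕ, 1 ≤ n → g (a * n + 1) = g (A * n + 1)) {q₀ : ℕ} (hq₀ : 1 ≤ q₀)
    (χ₀ : DirichletCharacter ℂ q₀) {R : ℝ}
    (hdist : ∀ x : ℝ, Sieve.pretentiousDistSq g (fun n => χ₀ n) x ≤ R) {p₀ : ℕ} (hp₀ : p₀.Prime)
    (hp₀q : ¬ p₀ ∣ q₀) (hp₀a : ¬ p₀ ∣ a) (hp₀A : ¬ p₀ ∣ A) : g p₀ = χ₀ p₀ := by
  rcases lt_or_gt_of_ne haA with h | h
  · exact apply_eq_char_of_lt hg hgu hm hpow ha h hrel hq₀ χ₀ hdist hp₀ hp₀q hp₀a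
  · exact apply_eq_char_of_lt hg hgu hm hpow hA h (fun n hn => (hrel n hn).symm) hq₀ χ₀ hdist hp₀
      hp₀q hp₀A

end Exactness


end ElliottKish2017

end Literature.NumberTheory.LFunctions
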